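/-
Copyright (c) 2026 the pub-hodgecm-mathlib formalisation cell (harness21).  Prover seat hodgecm-mathlib-K2E3-p11 (g5), Track B «K2-LIT» ∕ h413
(`stmt-HodgeConjecture-24833`), line `K2_E3_EllipticInputs`, unit U12 §L, Richardson road for (LBGL-ge3) at `N = 3` (road owner K2E3-p11), brick (F-E) =
(LBGL-3E) «THE (2,1)-PARABOLIC SLICE DENSITY OF 𝔤𝔩₃(F)», FILE H″6 «GLUING: the slice functional IS the density `w·μ𝔤`».  2026-09-04.
-/
import Summits.HodgeConjecture.HodgeConjecture.Theorems.K2E3GL3ParabolicSliceDensityLocal     -- ★ H″6b (this seat): `exists_open_local_density`, `setOf_discr_ne_zero_and_sum_eq_mem_nhds`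
import Summits.HodgeConjecture.HodgeConjecture.Theorems.K2E3GL3ParabolicSlicePieceIntegral    -- ★ H″1 (this seat): the ball-piece formula `exists_lintegral_levelSet_ball_indicator_eq`
import Mathlib.MeasureTheory.Measure.WithDensity
import HarnessLib

/-!
# K2_E3 road (h413), §L ∕ Richardson road at `N = 3`, brick (F-E) FILE H″6: gluing — the (2,1)-parabolic slice functional is `w · μ𝔤`

Cell `pub/hodgecm-mathlib` (D-0151), Track B, seat K2E3-p11 (g5) (road owner of (F-E) = (LBGL-3E) `sig_K2E3GL3ParabolicSliceDensity`; ROAD v2 on `K2/STATUS.md`,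
2026-09-04).  `--supports stmt-HodgeConjecture-24833 --as helper`; THEOREMS ONLY (no definition ∕ instance ∕ notation ∕ named fact ∕ `sorry`); never imports
`Cruxes/…/Lines`.  COUNT-NEUTRAL.

THE POINT.  With `w(X) = 1_{disc χ_X ≠ 0} · C · Σ_{a ∈ roots_F χ_X} ‖χ_X'(a)‖_F⁻¹` (`C` the universal constant of ★ H″1) we prove, for every measurable `h ≥ 0`,
  `∫⁻_K ∫⁻_{F⁷} h(k·P(r)·k⁻¹) dr dκ = ∫⁻ h · w dμ𝔤`,
GIVEN that the parabolic discriminant locus `{r | disc χ_{P(r)} = 0}` is `dr`-null (hypothesis `hnull`, brick H″4 of K2E3-p17 (g6)).  Proof: both sides are measures in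
`h = 1_S`; the left one is the push-forward `ρ` of `κ ⊗ dr` under `(k, r) ↦ Ad(k)P(r)`, the right one is `μ𝔤.withDensity w`; they agree on a neighbourhood of every
point of the open set `U = {disc ≠ 0}` (★ H″6b: `ρ|_V = e·μ𝔤|_V` and `w ≡ e` on `V`), hence on a countable union `O ⊇ U` of such neighbourhoods (Lindelöf,
`restrict_biUnion_congr`); and both vanish on `Oᶜ ⊆ Uᶜ` (`ρ(Uᶜ) = 0` by `hnull` and conjugation invariance of `charpoly`; `w = 0` off `U`).
* `measurable_density` (`w` is Borel: locally constant on the open `U`, zero off it);  **`exists_lintegral_parabolicSlice_eq_lintegral_mul_density`**.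
[HarishChandra1999AdmissibleDistributions, §7 Lemma 7.8, Thm. 4.4] [HarishChandra1970, Part V §4 Lemma 22]
HONEST LABEL: HC_CM is proved only modulo the 7 printed citations (2 remaining named inputs: hLiu418 = stmt-HodgeConjecture-24832, h413 = stmt-HodgeConjecture-24833)
until rung 0 closes; count-neutral helper ((LBGL-ge3)∕(LBGL-3E) NOT ★ here).

## References
* [HarishChandra1999AdmissibleDistributions] Harish-Chandra (DeBacker–Sally), *Admissible Invariant Distributions on Reductive p-adic Groups* (1999), §7, Lemma 7.8; Thm. 4.4.
* [HarishChandra1970] Harish-Chandra (van Dijk), *Harmonic Analysis on Reductive p-adic Groups*, LNM 162 (1970), Part V §4 Lemma 22.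
-/

set_option autoImplicit false
set_option linter.dupNamespace false

noncomputable section

open MeasureTheory Measure Filter Topology Set Matrix Polynomial
open scoped MatrixGroups NNReal ENNReal
open Literature.NumberTheory.Automorphic Literature.NumberTheory.Automorphic.LocalFieldHaar
open Literature.NumberTheory.GaloisRepresentations Literature.NumberTheory.GaloisRepresentations.IsNonarchimedeanLocalField
open Summit.HodgeConjecture.HodgeConjecture.Cruxes.H413

namespace Summit.HodgeConjecture.HodgeConjecture.Cruxes.H413.K2E3GL3ParabolicSliceDensityAE

variable {F : Type*} [Field F] [ValuativeRel F] [TopologicalSpace F] [IsNonarchimedeanLocalField F]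
  [MeasurableSpace F] [BorelSpace F]
  [MeasurableSpace (Matrix (Fin 3) (Fin 3) F)] [BorelSpace (Matrix (Fin 3) (Fin 3) F)]
  [MeasurableSpace (GL (Fin 3) F)] [BorelSpace (GL (Fin 3) F)]

omit [MeasurableSpace F] [BorelSpace F] [MeasurableSpace (GL (Fin 3) F)] [BorelSpace (GL (Fin 3) F)] in
/-- **The density is Borel**: `X ↦ 1_{disc ≠ 0}(X) · C · Σ_{a ∈ roots_F χ_X} ‖χ_X'(a)‖⁻¹` is measurable (locally constant on the open set `{disc ≠ 0}` by ★ R′, zero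
off it; `ContinuousOn.measurable_piecewise`). [cite: HarishChandra1999AdmissibleDistributions, §7] -/
theorem measurable_density (C : ℝ≥0∞) :
    Measurable fun X : Matrix (Fin 3) (Fin 3) F => ({X : Matrix (Fin 3) (Fin 3) F | X.charpoly.discr ≠ 0}).indicator
      (fun X => C * (X.charpoly.roots.map fun a => (((normAbs F (X.charpoly.derivative.eval a))⁻¹ : ℝ≥0) : ℝ≥0∞)).sum) X := by
  classical
  haveI : T2Space F := (isLocalField F).toT2Space
  have hU : IsOpen {X : Matrix (Fin 3) (Fin 3) F | X.charpoly.discr ≠ 0} :=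
    isOpen_ne_fun (F0P3cStCharTSHCDGroupToLie.continuous_discr_charpoly (K := F)) continuous_const
  have hcont : ContinuousOn (fun X : Matrix (Fin 3) (Fin 3) F =>
      C * (X.charpoly.roots.map fun a => (((normAbs F (X.charpoly.derivative.eval a))⁻¹ : ℝ≥0) : ℝ≥0∞)).sum)
      {X : Matrix (Fin 3) (Fin 3) F | X.charpoly.discr ≠ 0} := by
    intro X₀ hX₀
    refine ContinuousAt.continuousWithinAt ?_
    refine (continuousAt_const (y := C * (X₀.charpoly.roots.map fun a =>
      (((normAbs F (X₀.charpoly.derivative.eval a))⁻¹ : ℝ≥0) : ℝ≥0∞)).sum)).congr ?_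
    filter_upwards [K2E3GL3ParabolicSliceDensityLocal.setOf_discr_ne_zero_and_sum_eq_mem_nhds X₀ hX₀] with Y hY
    rw [hY.2]
  have h := ContinuousOn.measurable_piecewise hcont continuousOn_const hU.measurableSet (g := fun _ => (0 : ℝ≥0∞))
  rw [show (fun _ : Matrix (Fin 3) (Fin 3) F => (0 : ℝ≥0∞)) = 0 from rfl, Set.piecewise_eq_indicator] at h
  exact h

/-- **GLUING: THE (2,1)-PARABOLIC SLICE FUNCTIONAL IS THE DENSITY `w·μ𝔤`.**  `κ` a Haar measure on `K = GL₃(𝒪)`, `dx`, `μ𝔤` additive Haar measures on `F`, `𝔤𝔩₃(F)`;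
assume the parabolic discriminant locus is `dr`-null (`hnull`, ★ H″4).  There is `C ∈ (0, ∞)` such that for every measurable `h ≥ 0`,
`∫⁻_K ∫⁻_{F⁷} h(k·P(r)·k⁻¹) dr dκ = ∫⁻ h(X) · (1_{disc χ_X ≠ 0} · C · Σ_{a ∈ roots_F χ_X} ‖χ_X'(a)‖⁻¹) dμ𝔤(X)`.
[cite: HarishChandra1999AdmissibleDistributions, §7 Lemma 7.8, Thm. 4.4] [cite: HarishChandra1970, Part V §4 Lemma 22] -/
theorem exists_lintegral_parabolicSlice_eq_lintegral_mul_density (κ : Measure ↥(glInt 3 F)) [IsHaarMeasure κ] (dx : Measure F) [dx.IsAddHaarMeasure]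
    (μ𝔤 : Measure (Matrix (Fin 3) (Fin 3) F)) [μ𝔤.IsAddHaarMeasure]
    (hnull : (Measure.pi fun _ : Fin 7 => dx) {r : Fin 7 → F | ((!![r 0, r 1, r 2; r 3, r 4, r 5; 0, 0, r 6] : Matrix (Fin 3) (Fin 3) F)).charpoly.discr = 0} = 0) :
    ∃ C : ℝ≥0∞, C ≠ 0 ∧ C ≠ ⊤ ∧ ∀ h : Matrix (Fin 3) (Fin 3) F → ℝ≥0∞, Measurable h →
      ∫⁻ k : ↥(glInt 3 F), ∫⁻ r : Fin 7 → F,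
          h (((k : GL (Fin 3) F) : Matrix (Fin 3) (Fin 3) F) * !![r 0, r 1, r 2; r 3, r 4, r 5; 0, 0, r 6] *
            ((((k : GL (Fin 3) F))⁻¹ : GL (Fin 3) F) : Matrix (Fin 3) (Fin 3) F)) ∂(Measure.pi fun _ : Fin 7 => dx) ∂κ =
        ∫⁻ X, h X * ({X : Matrix (Fin 3) (Fin 3) F | X.charpoly.discr ≠ 0}).indicator
          (fun X => C * (X.charpoly.roots.map fun a => (((normAbs F (X.charpoly.derivative.eval a))⁻¹ : ℝ≥0) : ℝ≥0∞)).sum) X ∂μ𝔤 := by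
  classical
  haveI : T2Space F := (isLocalField F).toT2Space
  haveI : LocallyCompactSpace F := (isLocalField F).toLocallyCompactSpace
  haveI : SecondCountableTopology F := secondCountableTopology_localField F
  haveI : IsTopologicalRing F := inferInstance
  haveI : SecondCountableTopology (Matrix (Fin 3) (Fin 3) F) :=
    K2E3GLnMaximalParabolicDescent.secondCountableTopology_matrix (F := F) (m := Fin 3) (n := Fin 3)
  haveI : CompactSpace ↥(glInt 3 F) := isCompact_iff_compactSpace.1 (isCompact_glInt 3 F)
  haveI : IsFiniteMeasure κ := CompactSpace.isFiniteMeasure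
  obtain ⟨C, hC0, hCtop, hball⟩ := K2E3GL3ParabolicSlicePieceIntegral.exists_lintegral_levelSet_ball_indicator_eq (F := F) κ dx μ𝔤
  refine ⟨C, hC0, hCtop, fun h hh => ?_⟩
  -- notation
  set U : Set (Matrix (Fin 3) (Fin 3) F) := {X : Matrix (Fin 3) (Fin 3) F | X.charpoly.discr ≠ 0} with hU
  set w : Matrix (Fin 3) (Fin 3) F → ℝ≥0∞ := fun X => U.indicator
    (fun X => C * (X.charpoly.roots.map fun a => (((normAbs F (X.charpoly.derivative.eval a))⁻¹ : ℝ≥0) : ℝ≥0∞)).sum) X with hw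
  have hwm : Measurable w := measurable_density (F := F) C
  have hUo : IsOpen U := isOpen_ne_fun (F0P3cStCharTSHCDGroupToLie.continuous_discr_charpoly (K := F)) continuous_const
  set Ψ : ↥(glInt 3 F) × (Fin 7 → F) → Matrix (Fin 3) (Fin 3) F := fun p =>
    ((p.1 : GL (Fin 3) F) : Matrix (Fin 3) (Fin 3) F) * !![p.2 0, p.2 1, p.2 2; p.2 3, p.2 4, p.2 5; 0, 0, p.2 6] *
      ((((p.1 : GL (Fin 3) F))⁻¹ : GL (Fin 3) F) : Matrix (Fin 3) (Fin 3) F) with hΨ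
  have hΨc : Continuous Ψ := by
    have h1 : Continuous fun p : ↥(glInt 3 F) × (Fin 7 → F) => ((p.1 : GL (Fin 3) F) : Matrix (Fin 3) (Fin 3) F) :=
      (Units.continuous_val.comp continuous_subtype_val).comp continuous_fst
    have h2 : Continuous fun p : ↥(glInt 3 F) × (Fin 7 → F) => ((((p.1 : GL (Fin 3) F))⁻¹ : GL (Fin 3) F) : Matrix (Fin 3) (Fin 3) F) :=
      (Units.continuous_coe_inv.comp continuous_subtype_val).comp continuous_fst
    have h3 : Continuous fun p : ↥(glInt 3 F) × (Fin 7 → F) => (!![p.2 0, p.2 1, p.2 2; p.2 3, p.2 4, p.2 5; 0, 0, p.2 6] : Matrix (Fin 3) (Fin 3) F) :=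
      K2E3GL3ParabolicLieAdInvariant.continuous_parabolic.comp continuous_snd
    exact (h1.mul h3).mul h2
  have hΨm : Measurable Ψ := hΨc.measurable
  -- the two measures
  set π : Measure (↥(glInt 3 F) × (Fin 7 → F)) := κ.prod (Measure.pi fun _ : Fin 7 => dx) with hπ
  set ρ : Measure (Matrix (Fin 3) (Fin 3) F) := π.map Ψ with hρ
  set ν : Measure (Matrix (Fin 3) (Fin 3) F) := μ𝔤.withDensity w with hν
  -- the functional as an integral against `ρ`
  have hρint : ∀ φ : Matrix (Fin 3) (Fin 3) F → ℝ≥0∞, Measurable φ →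
      ∫⁻ k : ↥(glInt 3 F), ∫⁻ r : Fin 7 → F, φ (Ψ (k, r)) ∂(Measure.pi fun _ : Fin 7 => dx) ∂κ = ∫⁻ X, φ X ∂ρ := by
    intro φ hφ
    rw [hρ, lintegral_map hφ hΨm, hπ, lintegral_prod (fun p => φ (Ψ p)) (hφ.comp hΨm).aemeasurable]
  -- STEP 1: local agreement `ρ|_V = ν|_V` near every point of `U`
  have hlocal : ∀ X₀ ∈ U, ∃ V : Set (Matrix (Fin 3) (Fin 3) F), IsOpen V ∧ X₀ ∈ V ∧ ρ.restrict V = ν.restrict V := by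
    intro X₀ hX₀
    obtain ⟨V, hVo, hXV, e, hV, hwV⟩ := K2E3GL3ParabolicSliceDensityLocal.exists_open_local_density κ dx μ𝔤 C hball X₀ hX₀
    refine ⟨V, hVo, hXV, Measure.ext fun S hS => ?_⟩
    have hVm : MeasurableSet V := hVo.measurableSet
    rw [Measure.restrict_apply hS, Measure.restrict_apply hS]
    -- `ρ (S ∩ V) = e · μ𝔤 (S ∩ V)`
    have h1 : ρ (S ∩ V) = e * μ𝔤 (S ∩ V) := by
      have h := hV (S.indicator 1) (measurable_one.indicator hS)
      rw [← lintegral_indicator_one (hS.inter hVm), ← hρint _ (measurable_one.indicator (hS.inter hVm))]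
      have hind : ∀ Y : Matrix (Fin 3) (Fin 3) F, (S ∩ V).indicator (1 : Matrix (Fin 3) (Fin 3) F → ℝ≥0∞) Y = V.indicator (S.indicator 1) Y := by
        intro Y; rw [Set.inter_comm, ← Set.indicator_indicator]
      simp only [hind]
      rw [h, lintegral_indicator_one hS, Measure.restrict_apply hS]
    -- `ν (S ∩ V) = e · μ𝔤 (S ∩ V)` since `w = e` on `V`
    have h2 : ν (S ∩ V) = e * μ𝔤 (S ∩ V) := by
      rw [hν, withDensity_apply _ (hS.inter hVm)]
      have : ∀ Y ∈ S ∩ V, w Y = e := fun Y hY => by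
        rw [hw]; dsimp only
        rw [Set.indicator_of_mem (show Y ∈ U from (hwV Y hY.2).1)]
        exact (hwV Y hY.2).2
      rw [setLIntegral_congr_fun (hS.inter hVm) this, setLIntegral_const, mul_comm]
    rw [h1, h2]
  -- STEP 2: a countable subcover of `U`
  choose V hVo hXV hVeq using hlocal
  obtain ⟨T, hTU, hTc, hTunion⟩ := TopologicalSpace.isOpen_biUnion_countable U (fun X₀ => if hX : X₀ ∈ U then V X₀ hX else ∅)
    (fun X₀ hX₀ => by rw [dif_pos hX₀]; exact hVo X₀ hX₀)
  set O : Set (Matrix (Fin 3) (Fin 3) F) := ⋃ X₀ ∈ U, (if hX : X₀ ∈ U then V X₀ hX else ∅) with hO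
  have hUO : U ⊆ O := fun X₀ hX₀ => Set.mem_biUnion hX₀ (by rw [dif_pos hX₀]; exact hXV X₀ hX₀)
  have hOo : IsOpen O := isOpen_biUnion fun X₀ hX₀ => by rw [dif_pos hX₀]; exact hVo X₀ hX₀
  have hOm : MeasurableSet O := hOo.measurableSet
  have hρνO : ρ.restrict O = ν.restrict O := by
    rw [← hTunion, Measure.restrict_biUnion_congr hTc]
    intro X₀ hX₀
    rw [dif_pos (hTU hX₀)]
    exact hVeq X₀ (hTU hX₀)
  -- STEP 3: both measures vanish off `O ⊇ U`
  have hρO : ρ Oᶜ = 0 := by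
    refine measure_mono_null (Set.compl_subset_compl.2 hUO) ?_
    rw [← lintegral_indicator_one hUo.measurableSet.compl, ← hρint _ (measurable_one.indicator hUo.measurableSet.compl)]
    have hk : ∀ k : ↥(glInt 3 F), ∫⁻ r : Fin 7 → F, Uᶜ.indicator (1 : Matrix (Fin 3) (Fin 3) F → ℝ≥0∞) (Ψ (k, r)) ∂(Measure.pi fun _ : Fin 7 => dx) = 0 := by
      intro k
      have hsub : ∀ r : Fin 7 → F, Uᶜ.indicator (1 : Matrix (Fin 3) (Fin 3) F → ℝ≥0∞) (Ψ (k, r)) =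
          ({r : Fin 7 → F | ((!![r 0, r 1, r 2; r 3, r 4, r 5; 0, 0, r 6] : Matrix (Fin 3) (Fin 3) F)).charpoly.discr = 0}).indicator 1 r := by
        intro r
        have hiff : Ψ (k, r) ∈ Uᶜ ↔ r ∈ {r : Fin 7 → F | ((!![r 0, r 1, r 2; r 3, r 4, r 5; 0, 0, r 6] : Matrix (Fin 3) (Fin 3) F)).charpoly.discr = 0} := by
          simp only [hΨ, hU, Set.mem_compl_iff, Set.mem_setOf_eq, not_not, K2E3GL3OrbitChartDeriv.charpoly_conj_units]
        by_cases hr : r ∈ {r : Fin 7 → F | ((!![r 0, r 1, r 2; r 3, r 4, r 5; 0, 0, r 6] : Matrix (Fin 3) (Fin 3) F)).charpoly.discr = 0}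
        · rw [Set.indicator_of_mem (hiff.2 hr), Set.indicator_of_mem hr]; rfl
        · rw [Set.indicator_of_notMem (fun h' => hr (hiff.1 h')), Set.indicator_of_notMem hr]
      simp only [hsub]
      rw [lintegral_indicator_one, hnull]
      exact (isClosed_eq (F0P3cStCharTSHCDGroupToLie.continuous_discr_charpoly.comp K2E3GL3ParabolicLieAdInvariant.continuous_parabolic)
        continuous_const).measurableSet
    simp only [hk, lintegral_zero]
  have hνO : ν Oᶜ = 0 := by
    refine measure_mono_null (Set.compl_subset_compl.2 hUO) ?_
    rw [hν, withDensity_apply _ hUo.measurableSet.compl]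
    have : ∀ Y ∈ Uᶜ, w Y = 0 := fun Y hY => by rw [hw]; exact Set.indicator_of_notMem hY _
    rw [setLIntegral_congr_fun hUo.measurableSet.compl this, lintegral_zero]
  have hρν : ρ = ν := by
    rw [← Measure.restrict_add_restrict_compl (μ := ρ) hOm, ← Measure.restrict_add_restrict_compl (μ := ν) hOm, hρνO,
      Measure.restrict_eq_zero.2 hρO, Measure.restrict_eq_zero.2 hνO]
  -- conclusion
  rw [hρint h hh, hρν, hν, lintegral_withDensity_eq_lintegral_mul _ hwm hh]
  refine lintegral_congr fun X => ?_
  rw [Pi.mul_apply, mul_comm]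

end Summit.HodgeConjecture.HodgeConjecture.Cruxes.H413.K2E3GL3ParabolicSliceDensityAE

end
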